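import Summits.CriticalPhenomena.PercolationContinuityZ3.Theses.PercNearOneGluing
import Literature.Probability.Percolation.PercolationProofs
import Literature.Probability.Percolation.ConditionalPositiveAssociationProofs
import Literature.Probability.Percolation.TwoClusterConditionalAssociationProofs
import Summits.CriticalPhenomena.PercolationContinuityZ3.Theorems.PercNearOneGluingAdditiveGluingGoodBase
import Summits.CriticalPhenomena.PercolationContinuityZ3.Theorems.PercNearOneGluingAdditiveGluingGoodTwoRelays
import Summits.CriticalPhenomena.PercolationContinuityZ3.Theorems.PercNearOneGluingAdditiveGluingLemma5AnyRelay
import Summits.CriticalPhenomena.PercolationContinuityZ3.Theorems.PercNearOneGluingAdditiveGluingGoodStep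

/-! TTRL-lite variant V881 of stmt-CriticalPhenomena-4576 -/

namespace Summit.CriticalPhenomena.PercolationContinuityZ3.Theorems

open MeasureTheory Literature.Probability.LatticeModels Literature.Probability.Percolation
open scoped Classical BigOperators

/-- TTRL-lite variant V881 (`fix n := 4`) of the additive-gluing crux `stmt-CriticalPhenomena-4576`.
On `Fin 4` the hypothesis `4 ≤ (A.erase b).card` with `b ∈ A` is impossible
(`(A.erase b).card = A.card - 1 ≤ 3`), so the statement holds vacuously. -/
theorem additiveGluing_var881 :
    ∀ (w : Sym2 (Fin 4) → unitInterval) (A : Finset (Fin 4)) (o b : Fin 4) (t : ℝ), b ∈ A → 0 < t →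
      (∀ a ∈ A, 1 - t ≤ (prodBernoulli w).real (openConn a b)) →
      (∃ a₀ ∈ A, ∃ a₁ ∈ A, ∃ a₂ ∈ A, a₀ ≠ a₁ ∧ a₀ ≠ a₂ ∧ a₁ ≠ a₂ ∧
        (prodBernoulli w).real (openConn a₀ b) = 1 - t ∧
        (prodBernoulli w).real (openConn a₁ b) = 1 - t ∧
        (prodBernoulli w).real (openConn a₂ b) = 1 - t) →
      4 ≤ (A.erase b).card →
      ∑ W : Finset (Fin 4), ∑ N : Finset (Fin 4),
        (prodBernoulli w).real {ω : BondConfig (Fin 4) |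
            (Finset.univ.filter fun v => ω ∈ openConnIn ((↑A : Set (Fin 4))ᶜ) o v) = W ∧
            (A.filter fun a => ω ∈ openConnIn (insert a ((↑A : Set (Fin 4))ᶜ)) o a) = N} *
          (if N.Nonempty then
            1 - (prodBernoulli (fun e : Sym2 (Fin 4) =>
              if ∃ v ∈ W, v ∈ e then (0 : unitInterval) else w e)).real (⋃ a ∈ N, openConn a b)
          else 0) ≤ t := by
  intro w A o b t hb _ _ _ hcard
  exfalso
  have h₁ : (A.erase b).card = A.card - 1 := Finset.card_erase_of_mem hb
  have h₂ : A.card ≤ 4 := by simpa using Finset.card_le_univ A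
  omega

end Summit.CriticalPhenomena.PercolationContinuityZ3.Theorems
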